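import Summits.AtomisticToContinuum.BoseEinsteinCondensation.Theses.BECInsertionCorrector
import Literature.MathematicalPhysics.QuantumManyBody.BoseGasDirichletWall
import Literature.Barriers.AtomisticToContinuum.KineticGapLengthScalesFreeGas
import Summits.AtomisticToContinuum.BoseEinsteinCondensation.Theorems.PeriodicToDirichlet.Negative.RewardedFreeGasCap

/-!
# `BoundaryTransferWeak` (stmt-AtomisticToContinuum-0827): same-constant flat-mode transfer is false

Negative knowledge for the per-potential boundary-condition transfer crux `BoundaryTransferWeak`
(route file `Theses/BECInsertionCorrector.lean`), filed by its crux disprover (`--supports`; a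
refuted NATURAL STRENGTHENING, nothing here asserts a Theses statement):

every transfer mechanism on file for this crux lands in the Dirichlet box's FLAT (constant) mode
(`reward-pays-the-wall`: `occupation N (boxConstantMode L)`; `coupled-bath-relocation`: the flat
mode of an inner cube) before closing through `occupation_le_maxOccupation` / `le_condensateNumber`.
The strengthening "torus BEC with constant `c` ⇒ flat-mode BEC of the Dirichlet near-minimisers
WITH THE SAME `c`" is FALSE, already at `v = 0`:

* `torusBEC_zero_of_lt_one` — the free torus gas satisfies the crux's hypothesis at every density
  with EVERY constant `c < 1` (slack `(1−c)N/(C L_N²)`, from LSSY Lemma 4.1 of the tree,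
  `natCast_le_condensateOccupation_add`);
* `not_flatModeBEC_zero` — flat-mode BEC of the free Dirichlet near-minimisers fails for every
  `c ≥ flatCap` (`flatCap < 1` universal, landed in `…/PeriodicToDirichlet/Negative/RewardedFreeGasCap`;
  in truth `∏ sin` puts `(8/π²)³ = 0.5326` of its mass in the flat mode while being fully condensed);
* `not_flatModeTransferSameConstant`, `not_flatModeTransferSameConstant_at` — hence no
  same-constant flat-mode transfer, neither in the crux's `∃ ρ₀ ∀ ρ < ρ₀` shape nor at any single
  density. READING: a flat-mode transfer must carry an explicit `O(1)` loss (the crux itself,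
  being about `λ_max`, loses nothing at `v = 0`).

All `[folklore]`; theorems only.
-/

noncomputable section

namespace Summit.AtomisticToContinuum.BoseEinsteinCondensation.Theorems.BoundaryTransferWeak.Negative

open Literature.MathematicalPhysics.QuantumManyBody.BoseGas
open Literature.Barriers.AtomisticToContinuum.BoseGas
open _root_.MeasureTheory _root_.Filter _root_.Topology
open scoped ENNReal NNReal

open Summit.AtomisticToContinuum.BoseEinsteinCondensation.Theorems.PeriodicToDirichlet.Negative
  (flatCap flatCap_lt_one RewardedBoxBECAt rewardedEnergy_of_nonpos rewardedInf_of_nonpos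
    not_rewardedBoxBECAt_zero_flatCap)

variable {ρ c : ℝ}

/-- **The free torus gas condenses with EVERY constant `c < 1`** at every density: the crux's
hypothesis at `v = 0` (slack `δ_N = (1−c)N/(C L_N²)`; `N ≤ n₀ + C L²⟨Ψ,HΨ⟩`, LSSY Lemma 4.1).
[folklore] -/
theorem torusBEC_zero_of_lt_one (hρ : 0 < ρ) (hc : c < 1) :
    ∀ᶠ N : ℕ in atTop, ∃ δ : ℝ≥0∞, 0 < δ ∧
      ∀ Ψ : PeriodicTrialState N (sideLength ρ N),
        periodicEnergy 0 Ψ ≤ periodicGroundStateEnergy 0 N (sideLength ρ N) + δ →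
          ENNReal.ofReal (c * N) ≤ condensateOccupation N (sideLength ρ N) Ψ.ψ := by
  obtain ⟨C, hC, h⟩ := natCast_le_condensateOccupation_add
  filter_upwards [eventually_gt_atTop 1] with N hN
  have hN0 : 0 < N := lt_trans zero_lt_one hN
  have hNr : (0 : ℝ) < N := Nat.cast_pos.2 hN0
  have hL : 0 < sideLength ρ N := sideLength_pos_of_pos hρ hN0
  have h1c : 0 < 1 - c := by linarith
  refine ⟨ENNReal.ofReal ((1 - c) * N / (C * sideLength ρ N ^ 2)), ?_, fun Ψ hΨ => ?_⟩
  · rw [ENNReal.ofReal_pos]; positivity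
  · rw [periodicGroundStateEnergy_zero_eq_zero N hL, zero_add] at hΨ
    have key := h N (sideLength ρ N) hN hL 0 Ψ
    have hwin : ENNReal.ofReal (C * sideLength ρ N ^ 2) * periodicEnergy 0 Ψ ≤
        ENNReal.ofReal ((1 - c) * N) := by
      calc ENNReal.ofReal (C * sideLength ρ N ^ 2) * periodicEnergy 0 Ψ
          ≤ ENNReal.ofReal (C * sideLength ρ N ^ 2) *
              ENNReal.ofReal ((1 - c) * N / (C * sideLength ρ N ^ 2)) := by gcongr
        _ = ENNReal.ofReal ((1 - c) * N) := by
            rw [← ENNReal.ofReal_mul (by positivity)]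
            congr 1
            field_simp
    have h2 : (N : ℝ≥0∞) ≤
        condensateOccupation N (sideLength ρ N) Ψ.ψ + ENNReal.ofReal ((1 - c) * N) :=
      key.trans (add_le_add le_rfl hwin)
    rcases le_or_gt c 0 with hc0 | hc0
    · rw [ENNReal.ofReal_of_nonpos (mul_nonpos_of_nonpos_of_nonneg hc0 hNr.le)]
      exact bot_le
    have hsplit : (N : ℝ≥0∞) = ENNReal.ofReal (c * N) + ENNReal.ofReal ((1 - c) * N) := by
      rw [← ENNReal.ofReal_add (by positivity) (by positivity), ← ENNReal.ofReal_natCast]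
      congr 1
      ring
    rw [hsplit] at h2
    exact (ENNReal.add_le_add_iff_right ENNReal.ofReal_ne_top).1 h2

/-- **Flat-mode BEC of the FREE Dirichlet near-minimisers fails from `flatCap` on** (any
density): with the box's constant mode `boxConstantMode L = L^{-3/2} 1_{Λ_L}`. [folklore] -/
theorem not_flatModeBEC_zero (hρ : 0 < ρ) (hc : flatCap ≤ c) :
    ¬ (∀ᶠ N : ℕ in atTop, ∃ δ : ℝ≥0∞, 0 < δ ∧
        ∀ Ψ : TrialState N (sideLength ρ N),
          energy 0 Ψ ≤ groundStateEnergy 0 N (sideLength ρ N) + δ →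
            ENNReal.ofReal (c * N) ≤ occupation N (boxConstantMode (sideLength ρ N)) Ψ.ψ) := by
  intro h
  refine not_rewardedBoxBECAt_zero_flatCap hρ ?_
  unfold RewardedBoxBECAt
  simp only [rewardedEnergy_of_nonpos 0 le_rfl, rewardedInf_of_nonpos 0 le_rfl]
  refine h.mono fun N ⟨δ, hδ, hΨ⟩ => ⟨δ, hδ, fun Ψ hE => le_trans ?_ (hΨ Ψ hE)⟩
  exact ENNReal.ofReal_le_ofReal (mul_le_mul_of_nonneg_right hc N.cast_nonneg)

/-- A constant in `[flatCap, 1) ∩ (0, 1)`. [folklore] -/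
theorem exists_const_between : ∃ c : ℝ, 0 < c ∧ c < 1 ∧ flatCap ≤ c := by
  refine ⟨(max flatCap 0 + 1) / 2, ?_, ?_, ?_⟩
  · have hm0 : 0 ≤ max flatCap 0 := le_max_right _ _
    linarith
  · have hm1 : max flatCap 0 < 1 := max_lt flatCap_lt_one one_pos
    linarith
  · have hmf : flatCap ≤ max flatCap 0 := le_max_left _ _
    have hm1 : max flatCap 0 < 1 := max_lt flatCap_lt_one one_pos
    linarith

/-- **Same-constant flat-mode transfer is FALSE** (the crux's quantifier shape, with its
mode-free conclusion replaced by flat-mode BEC at the SAME constant; witness `v = 0`). [folklore] -/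
theorem not_flatModeTransferSameConstant :
    ¬ (∀ v : ℝ → ℝ≥0∞, IsRepulsiveFiniteRange v → ∃ ρ₀ : ℝ, 0 < ρ₀ ∧ ∀ ρ : ℝ, 0 < ρ → ρ < ρ₀ →
        ∀ c : ℝ, 0 < c →
          (∀ᶠ N : ℕ in atTop, ∃ δ : ℝ≥0∞, 0 < δ ∧
            ∀ Ψ : PeriodicTrialState N (sideLength ρ N),
              periodicEnergy v Ψ ≤ periodicGroundStateEnergy v N (sideLength ρ N) + δ →
                ENNReal.ofReal (c * N) ≤ condensateOccupation N (sideLength ρ N) Ψ.ψ) →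
          ∀ᶠ N : ℕ in atTop, ∃ δ : ℝ≥0∞, 0 < δ ∧
            ∀ Ψ : TrialState N (sideLength ρ N),
              energy v Ψ ≤ groundStateEnergy v N (sideLength ρ N) + δ →
                ENNReal.ofReal (c * N) ≤ occupation N (boxConstantMode (sideLength ρ N)) Ψ.ψ) := by
  intro h
  obtain ⟨ρ₀, hρ₀, H⟩ := h 0 ⟨measurable_const, 0, fun _ _ => rfl⟩
  obtain ⟨c, hc0, hc1, hcap⟩ := exists_const_between
  have hρ : 0 < ρ₀ / 2 := by positivity
  exact not_flatModeBEC_zero hρ hcap (H (ρ₀ / 2) hρ (by linarith) c hc0 (torusBEC_zero_of_lt_one hρ hc1))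

/-- … and at every single density (no `ρ₀` to hide behind). [folklore] -/
theorem not_flatModeTransferSameConstant_at (hρ : 0 < ρ) :
    ¬ (∀ c : ℝ, 0 < c →
        (∀ᶠ N : ℕ in atTop, ∃ δ : ℝ≥0∞, 0 < δ ∧
          ∀ Ψ : PeriodicTrialState N (sideLength ρ N),
            periodicEnergy 0 Ψ ≤ periodicGroundStateEnergy 0 N (sideLength ρ N) + δ →
              ENNReal.ofReal (c * N) ≤ condensateOccupation N (sideLength ρ N) Ψ.ψ) →
        ∀ᶠ N : ℕ in atTop, ∃ δ : ℝ≥0∞, 0 < δ ∧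
          ∀ Ψ : TrialState N (sideLength ρ N),
            energy 0 Ψ ≤ groundStateEnergy 0 N (sideLength ρ N) + δ →
              ENNReal.ofReal (c * N) ≤ occupation N (boxConstantMode (sideLength ρ N)) Ψ.ψ) := by
  intro H
  obtain ⟨c, hc0, hc1, hcap⟩ := exists_const_between
  exact not_flatModeBEC_zero hρ hcap (H c hc0 (torusBEC_zero_of_lt_one hρ hc1))

end Summit.AtomisticToContinuum.BoseEinsteinCondensation.Theorems.BoundaryTransferWeak.Negative

end
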